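import Literature.Computability.Cryptography.LWEFirstIsErrorlessReduction
import Literature.Algebra.Module.UnimodularCompletionZMod
import HarnessLib

/-!
# BLPRS 2013, Lemma 4.3 over `ℤ/qℤ`: the abort probability `∑_{p | q} p^{-n}` and the lemma as printed

Topic `Computability/Cryptography` (LWE), grouping namespace `LWE`; completes
`LWEFirstIsErrorless.lean` / `LWEFirstIsErrorlessReduction.lean` (Def. 4.2, the reduction of
Lemma 4.3 as a kernel `felTransform Good cpl m` with an abstract abort rule `Good` and completion `cpl`,
and `felAdvantage_le : Adv_fel(D) ≤ Adv(felReduction D) + Pr[¬ Good]`) with the printed abort rule over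
`R = ℤ/qℤ`, towards `Literature.Computability.Cryptography.blprs_gapSVP_sqrt_dim_to_lwe_classical`
(**pqc.S21**). Printed (proof of Lemma 4.3): *"Let `r` be the greatest common divisor of the
coordinates of `a'`. If it is not coprime to `q`, we abort. The probability that this happens is at most
`∑_{p prime, p | q} p^{-n}`."* Here `Good = IsUnimodularVector` (the coordinates generate the unit ideal
of `ℤ/qℤ`, equivalently no prime `p | q` divides all of them: `isUnimodularVector_iff_forall_prime` of
`Algebra/Module/UnimodularCompletionZMod.lean`, which also supplies the completion
`unimodularCompletion` — invertible, leftmost column `a'`), and: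

* `card_filter_dvd_val` — `#{x ∈ ℤ/qℤ : p | x.val} = q/p` for `p | q`; `card_filter_forall_dvd_val` —
  `#{a' ∈ (ℤ/qℤ)^{k+1} : p | a'ᵢ ∀ i} = (q/p)^{k+1}`;
* `card_filter_not_isUnimodularVector_le` — `#{a' : ¬ unimodular} ≤ ∑_{p | q} (q/p)^{k+1}` (union bound
  over the prime factors);
* `badFraction_isUnimodularVector_le` — **`Pr_{a' ← U}[abort] ≤ ∑_{p | q prime} p^{-(k+1)}`**;
* **`felAdvantage_le_sum_primeFactors`** — **Lemma 4.3 as printed** (`n = k + 1`, any noise law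
  `χ` on `ℤ/qℤ`, any `m`): for every first-is-errorless distinguisher `D`,
  `Adv_fel(D) ≤ Adv_{LWE_{k,m,q,χ}}(felReduction D) + ∑_{p | q prime} p^{-(k+1)}`, the reduction being
  the printed transformation with abort rule "coordinates of `a'` not coprime to `q`" and any
  completion of the specification (here `unimodularCompletion`).

## References

* Z. Brakerski, A. Langlois, C. Peikert, O. Regev, D. Stehlé, *Classical hardness of learning with
  errors*, STOC 2013; arXiv:1306.0281, §4.1, Lemma 4.3 and its proof.
-/

noncomputable section

open scoped ENNReal

namespace Literature.Computability.Cryptography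

namespace LWE

open Literature.Algebra.Module Finset

section ZModAbort

variable {q : ℕ} [NeZero q] {k : ℕ}

omit [NeZero q] in
/-- Multiples of `p | q` below `q`: `{j < q : p | j} = {p i : i < q/p}`. [folklore] -/
theorem filter_range_dvd_eq_image_mul {p : ℕ} (hpq : p ∣ q) (hp : 0 < p) :
    (Finset.range q).filter (fun j => p ∣ j) = (Finset.range (q / p)).image (fun i => p * i) := by
  obtain ⟨c, hc⟩ := hpq
  have hqp : q / p = c := by rw [hc, Nat.mul_div_cancel_left c hp]
  rw [hqp]
  ext j
  simp only [Finset.mem_filter, Finset.mem_range, Finset.mem_image]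
  constructor
  · rintro ⟨hj, ⟨i, rfl⟩⟩
    exact ⟨i, (Nat.mul_lt_mul_left hp).mp (hc ▸ hj), rfl⟩
  · rintro ⟨i, hi, rfl⟩
    exact ⟨hc ▸ (Nat.mul_lt_mul_left hp).mpr hi, dvd_mul_right p i⟩

/-- **`#{x ∈ ℤ/qℤ : p | x.val} = q / p`** for `p | q` (the representatives `x.val ∈ [0, q)` divisible
by `p`). [folklore] -/
theorem card_filter_dvd_val {p : ℕ} (hpq : p ∣ q) (hp : 0 < p) :
    (Finset.univ.filter fun x : ZMod q => p ∣ x.val).card = q / p := by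
  have himage : (Finset.univ.filter fun x : ZMod q => p ∣ x.val).image ZMod.val =
      (Finset.range q).filter fun j => p ∣ j := by
    ext j
    simp only [Finset.mem_image, Finset.mem_filter, Finset.mem_univ, true_and, Finset.mem_range]
    constructor
    · rintro ⟨x, hx, rfl⟩
      exact ⟨ZMod.val_lt x, hx⟩
    · rintro ⟨hj, hpj⟩
      refine ⟨(j : ZMod q), ?_, ZMod.val_natCast_of_lt hj⟩
      rwa [ZMod.val_natCast_of_lt hj]
  rw [← Finset.card_image_of_injective _ (ZMod.val_injective q), himage,
    filter_range_dvd_eq_image_mul hpq hp, Finset.card_image_of_injective _ (mul_right_injective₀ hp.ne'),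
    Finset.card_range]

/-- **`#{a' ∈ (ℤ/qℤ)^{k+1} : p | a'ᵢ for all i} = (q/p)^{k+1}`** for `p | q`. [folklore] -/
theorem card_filter_forall_dvd_val {p : ℕ} (hpq : p ∣ q) (hp : 0 < p) :
    (Finset.univ.filter fun v : Fin (k + 1) → ZMod q => ∀ i, p ∣ (v i).val).card = (q / p) ^ (k + 1) := by
  have hset : (Finset.univ.filter fun v : Fin (k + 1) → ZMod q => ∀ i, p ∣ (v i).val) =
      Fintype.piFinset fun _ : Fin (k + 1) => Finset.univ.filter fun x : ZMod q => p ∣ x.val := by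
    ext v
    simp only [Finset.mem_filter, Finset.mem_univ, true_and, Fintype.mem_piFinset]
  rw [hset, Fintype.card_piFinset, Finset.prod_const, Finset.card_univ, Fintype.card_fin,
    card_filter_dvd_val hpq hp]

/-- **Union bound over the prime factors**: the non-unimodular vectors of `(ℤ/qℤ)^{k+1}` are covered by
the sets "all coordinates divisible by `p`", `p | q` prime (`isUnimodularVector_of_forall_prime`), so
there are at most `∑_{p | q} (q/p)^{k+1}` of them. [cite: BrakerskiEtAl2013, Lemma 4.3 (proof: "The probability that this happens is at most ∑_{p prime, p|q} p^{-n}")] -/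
theorem card_filter_not_isUnimodularVector_le :
    (Finset.univ.filter fun v : Fin (k + 1) → ZMod q => ¬ IsUnimodularVector v).card ≤
      ∑ p ∈ q.primeFactors, (q / p) ^ (k + 1) := by
  classical
  calc (Finset.univ.filter fun v : Fin (k + 1) → ZMod q => ¬ IsUnimodularVector v).card
      ≤ (q.primeFactors.biUnion fun p =>
          Finset.univ.filter fun v : Fin (k + 1) → ZMod q => ∀ i, p ∣ (v i).val).card := by
        refine Finset.card_le_card fun v hv => ?_
        rw [Finset.mem_filter] at hv
        rw [Finset.mem_biUnion]
        by_contra hcov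
        push Not at hcov
        refine hv.2 (isUnimodularVector_of_forall_prime fun p hp => ?_)
        have h := hcov p hp
        rw [Finset.mem_filter, not_and] at h
        exact not_forall.1 (h (Finset.mem_univ v))
    _ ≤ ∑ p ∈ q.primeFactors, (Finset.univ.filter fun v : Fin (k + 1) → ZMod q => ∀ i, p ∣ (v i).val).card :=
        Finset.card_biUnion_le
    _ = ∑ p ∈ q.primeFactors, (q / p) ^ (k + 1) :=
        Finset.sum_congr rfl fun p hp => card_filter_forall_dvd_val (Nat.dvd_of_mem_primeFactors hp)
          (Nat.prime_of_mem_primeFactors hp).pos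

/-- **The abort probability of Lemma 4.3**: `Pr_{a' ← U((ℤ/qℤ)^{k+1})}[a' not unimodular] ≤
∑_{p | q prime} p^{-(k+1)}` (printed with `n = k + 1`; `(q/p)^{k+1}/q^{k+1} = p^{-(k+1)}` exactly since
`p | q`). [cite: BrakerskiEtAl2013, Lemma 4.3 (proof)] -/
theorem badFraction_isUnimodularVector_le :
    badFraction (fun v : Fin (k + 1) → ZMod q => IsUnimodularVector v) ≤
      ∑ p ∈ q.primeFactors, ((p : ℝ) ^ (k + 1))⁻¹ := by
  classical
  have hq : (0 : ℝ) < q := by exact_mod_cast Nat.pos_of_ne_zero (NeZero.ne q)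
  have hcard : (Fintype.card (Fin (k + 1) → ZMod q) : ℝ) = (q : ℝ) ^ (k + 1) := by
    rw [Fintype.card_fun, Fintype.card_fin, ZMod.card, Nat.cast_pow]
  rw [badFraction, hcard, div_le_iff₀ (by positivity), Finset.sum_mul]
  have hle : ((Finset.univ.filter fun v : Fin (k + 1) → ZMod q => ¬ IsUnimodularVector v).card : ℝ) ≤
      ((∑ p ∈ q.primeFactors, (q / p) ^ (k + 1) : ℕ) : ℝ) := by
    exact_mod_cast card_filter_not_isUnimodularVector_le
  refine hle.trans (le_of_eq ?_)
  rw [Nat.cast_sum]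
  refine Finset.sum_congr rfl fun p hp => ?_
  have hp0 : (p : ℝ) ≠ 0 := by exact_mod_cast (Nat.prime_of_mem_primeFactors hp).ne_zero
  rw [Nat.cast_pow, Nat.cast_div (Nat.dvd_of_mem_primeFactors hp) hp0, div_pow, div_eq_inv_mul]

/-- **BLPRS 2013, Lemma 4.3, as printed** (discrete model, `n = k + 1`, any noise law `χ` on `ℤ/qℤ`,
any number `m` of samples): the transformation reduction `felTransform` with the printed abort rule
(abort unless the coordinates of `a'` generate the unit ideal, i.e. their gcd is coprime to `q`) and a
completion `U` of `a'` to a matrix invertible modulo `q` (`unimodularCompletion`), followed by a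
first-is-errorless distinguisher `D` for `LWE_{k+1, 1+m, q, χ}`, is an `LWE_{k, m, q, χ}` distinguisher
losing at most `∑_{p | q prime} p^{-(k+1)}` in advantage:
`Adv_fel(D) ≤ Adv_{LWE_{k,m}}(felReduction D) + ∑_{p | q} p^{-(k+1)}`. (The reduction is a kernel on
sample tuples; its polynomial running time is a property of the machine realising it, not stated here.)
[cite: BrakerskiEtAl2013, Lemma 4.3] -/
theorem felAdvantage_le_sum_primeFactors (χ : PMF (ZMod q)) (m : ℕ)
    (D : ((Fin (k + 1) → ZMod q) × ZMod q) × (Fin m → (Fin (k + 1) → ZMod q) × ZMod q) → PMF Bool) :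
    felAdvantage χ m D ≤
      distinguishingAdvantage χ m
          (felReduction (fun v : Fin (k + 1) → ZMod q => IsUnimodularVector v) unimodularCompletion m D) +
        ∑ p ∈ q.primeFactors, ((p : ℝ) ^ (k + 1))⁻¹ :=
  (felAdvantage_le χ (Good := fun v : Fin (k + 1) → ZMod q => IsUnimodularVector v)
      (fun _ h => unimodularCompletion_spec h) m D).trans
    (add_le_add le_rfl badFraction_isUnimodularVector_le)

end ZModAbort

end LWE

end Literature.Computability.Cryptography

end
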